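import Summits.BirchSwinnertonDyer.BirchSwinnertonDyer.Theorems.AdditiveKolyvaginRoadLevelSystemsEvenLevels
import Summits.BirchSwinnertonDyer.BirchSwinnertonDyer.Theorems.AdditiveKolyvaginRoadLevelBasics
import Summits.BirchSwinnertonDyer.BirchSwinnertonDyer.Theorems.AdditiveKolyvaginRoadEigen
import Summits.BirchSwinnertonDyer.BirchSwinnertonDyer.Theorems.AdditiveKolyvaginRoadKolyvaginPrimitiveAdditiveRankLowering
import Summits.BirchSwinnertonDyer.BirchSwinnertonDyer.Theorems.KolyvaginRoadThreeMethod2ParityRank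
import HarnessLib

/-!
# Route `AdditiveKolyvaginRoad`, crux `LevelKolyvaginSystemsAdditive` (item stmt-BirchSwinnertonDyer-21396, KS′):
# THE BIPARTITE DICTIONARY, part 2 — `baseCase` from the rank-0 ANCHOR AT ODD LEVELS, the first floor (BOT′-shape),
# and the assembly of a `LevelKolyvaginSystemP` from one bipartite datum
# (cell `pub/bsd-wall`, width seat `bsd-wall-akr-p2x-w2` g0 on line `birth`; `--supports stmt-BirchSwinnertonDyer-21396`, helper;
# part 1 = `AdditiveKolyvaginRoadLevelSystemsEvenLevels`)

WHY. Part 1 showed that a `LevelKolyvaginSystemP W K p Dt β ι c` owes classes only at EVEN levels and that its `transport`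
field is the composite of the two ONE-DIRECTIONAL Bertolini–Darmon reciprocity halves (A⇐) ∕ (B⇒) through values
`λ(m, n) ∈ 𝔽_p` at the ODD levels. The other forcing field, `baseCase` (W. Zhang 2014 Thm. 7.2 at every even level of
canonical rank one: `κ(∅, n) ≠ 0`), is in print a CONSEQUENCE of the rank-0 ANCHOR at ODD levels — (γ) `Sel_{n'} = 0 ⟹
λ(∅, n') ≠ 0` (Zhang Thm. 7.1, the Skinner–Urban direction for the level-raised form `g_{n'}` on the DEFINITE algebra,
read through the Gross formula) — by Zhang's own argument (proof of Thm. 7.2, pp. 232–233): the line `Sel_n^μ = 𝔽_p x` is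
killed at one NEW admissible prime `q` (rank lowering (A1), LANDED as `stub_rankLoweringAdditive`, p521749), the odd level
`n∪q` has rank zero, (γ) gives `λ(∅, n∪q) ≠ 0`, and (A⇐) reads it as `loc_q κ(∅, n) ≠ 0`. This file:

* §1 `ne_zero_of_anchor_above` — the level-local core: at ONE level `n` of total canonical rank one, (A1) at `n` + the
  anchor at the levels `n∪q` + (A⇐) for the class at `n` ⟹ the class is non-zero (no parity needed).
* §2 `baseCase_of_oddLevelAnchor` — the field `baseCase` at every EVEN level from (A1), (A⇐) at `m = ∅`, (γ) at odd levels.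
* §3 THE FIRST FLOOR (level `∅`): `kolyvaginClass_one_ne_zero_of_firstFloor` — at `#Sel_p(E/K) = p`, the conductor-one
  Kolyvagin class `c(1) mod p` of ANY Kolyvagin–Heegner datum is non-zero GIVEN (A1) at level `∅`, the values `λ(∅, {q})`
  with (A⇐) at level `∅` (Gross ∕ Jochnowitz: `loc_q c(1) ≠ 0 ⟸ λ(∅,{q}) ≠ 0`) and (γ) at the one-prime levels — the
  conclusion of crux BOT′ (`BottomRankOneAdditive`, 21397) from the FIRST FLOOR of the bipartite system alone (the p-generic,
  Brandt-free analogue of koly g16's `Method2DefiniteFirstFloor` at `p = 3`); `…_at_frame` discharges (A1).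
* §4 `nonempty_levelKolyvaginSystemP_of_bipartite` (abstract) and `…_at_frame` (♯ additive frame, (A1) discharged): KS′'s
  `Nonempty (LevelKolyvaginSystemP …)` from ONE displayed bipartite datum {`ε₀`, even-level `κ₀`, odd-level `λ`, local
  axioms at even levels, (A⇐), (B⇒), (γ)}.

EFFECT FOR THE CRUX (planner's business, recorded): KS′ ⟸ (BES) a mod-`p` bipartite system for `(E, K, p)` at the
additive prime extending E's Kolyvagin classes (type-preserving level raising + BD reciprocity at `p²`-level) ∧ (γ) the
rank-0 anchor at the DEFINITE levels only; and BOT′ ⟸ its first floor. Neither input is asserted here.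

HONEST FRAMING: theorems only; 0 definitions, 0 named facts, 0 `sorry`; every bipartite input is an explicit HYPOTHESIS
(binder); closes nothing. BSD is not proved by any of this.

References: [cite: WZhang2014, Thm. 4.3, (4.8), Prop. 5.4, Thm. 7.1, Thm. 7.2 (proof pp. 232–233), §8.1, §9]
[cite: BertoliniDarmon2005, Thm. 4.1, Thm. 4.2] [cite: GrossLMS1991, §4 (4.4), §10].
-/

-- single-conjunct summit: `Summit.BirchSwinnertonDyer.BirchSwinnertonDyer.…` repeats the name by design
set_option linter.dupNamespace false

noncomputable section

open scoped Classical

namespace Summit.BirchSwinnertonDyer.BirchSwinnertonDyer.Theorems.AdditiveKoly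

open WeierstrassCurve NumberField IsDedekindDomain
  Literature.NumberTheory.EllipticCurves Literature.NumberTheory.EllipticCurves.ModularForms
  Literature.NumberTheory.EllipticCurves.Rank1Residual Literature.NumberTheory.GaloisRepresentations Module
  Summit.BirchSwinnertonDyer.Rank1Residual.X11b.Three.Koly

variable (W : WeierstrassCurve ℚ) (K : Type) [Field K] [NumberField K] (p : ℕ) [W.IsGloballyMinimal] [Fact p.Prime]
  (c : K ≃ₐ[ℚ] K) [Module (ZMod p) (Vp W K p)]

/-! ## §1 The level-local core -/

/-- **One level of rank one, an anchor one prime up, a reading law ⟹ the class is non-zero** (the core of W. Zhang's proof of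
Thm. 7.2). At a level `n` with `dim Sel_n⁺ + dim Sel_n⁻ = 1`: IF (A1) every non-zero class of `Sel_n^μ` is killed in
`Sel_{n∪q}^μ` for some NEW admissible `q` with codimension one and the other sign unchanged, (γ) the value `λ_q` is non-zero
whenever the level `n∪q` has total canonical rank zero, and (A⇐) `λ_q ≠ 0` makes the class `y` NOT locally trivial above
`q` — THEN `y ≠ 0`. [cite: WZhang2014, Thm. 7.2 (proof pp. 232–233), Prop. 5.4, Thm. 7.1, (4.8)] -/
theorem ne_zero_of_anchor_above {y : Vp W K p} (n : Finset (AdmQ W K p)) {lamq : AdmQ W K p → ZMod p}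
    (hA1n : ∀ (μ : Bool) (x : Vp W K p), x ∈ SelQP W K p c n μ → x ≠ 0 →
      ∃ q : AdmQ W K p, q ∉ n ∧ x ∉ SelQP W K p c (insert q n) μ ∧
        SelQP W K p c (insert q n) μ ≤ SelQP W K p c n μ ∧
        finrank (ZMod p) (SelQP W K p c (insert q n) μ) + 1 = finrank (ZMod p) (SelQP W K p c n μ) ∧
        SelQP W K p c (insert q n) (!μ) = SelQP W K p c n (!μ))
    (lawAn : ∀ q : AdmQ W K p, q ∉ n → lamq q ≠ 0 → ∃ v : HeightOneSpectrum (𝓞 K), ((q : ℕ) : 𝓞 K) ∈ v.asIdeal ∧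
      y ∉ (W.baseChange K).torsionLocalKer (v.adicCompletion K) ((p ^ 1 : ℕ) : ℤ))
    (anchorn : ∀ q : AdmQ W K p, q ∉ n →
      finrank (ZMod p) (SelQP W K p c (insert q n) true) + finrank (ZMod p) (SelQP W K p c (insert q n) false) = 0 →
      lamq q ≠ 0)
    (h1 : finrank (ZMod p) (SelQP W K p c n true) + finrank (ZMod p) (SelQP W K p c n false) = 1) : y ≠ 0 := by
  -- the sign `μ` carrying the rank-one line, the other sign trivial
  obtain ⟨μ, hμ1, hμ0⟩ : ∃ μ : Bool, finrank (ZMod p) (SelQP W K p c n μ) = 1 ∧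
      finrank (ZMod p) (SelQP W K p c n (!μ)) = 0 := by
    rcases Nat.eq_zero_or_pos (finrank (ZMod p) (SelQP W K p c n true)) with h | h
    · exact ⟨false, by omega, h⟩
    · exact ⟨true, by omega, by change finrank (ZMod p) (SelQP W K p c n false) = 0; omega⟩
  -- a non-zero class `x` on the line
  have hne : SelQP W K p c n μ ≠ ⊥ := by
    intro h
    rw [h, finrank_bot] at hμ1
    exact zero_ne_one hμ1
  obtain ⟨x, hx, hx0⟩ := Submodule.exists_mem_ne_zero_of_ne_bot hne
  -- (A1): a NEW admissible prime `q` kills the line; the level `n ∪ q` has total canonical rank zero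
  obtain ⟨q, hqn, -, -, hrank, hother⟩ := hA1n μ x hx hx0
  have hzero : finrank (ZMod p) (SelQP W K p c (insert q n) true) +
      finrank (ZMod p) (SelQP W K p c (insert q n) false) = 0 := by
    have hμ' : finrank (ZMod p) (SelQP W K p c (insert q n) μ) = 0 := by omega
    have hμ'' : finrank (ZMod p) (SelQP W K p c (insert q n) (!μ)) = 0 := by rw [hother]; exact hμ0
    cases μ
    · change finrank (ZMod p) (SelQP W K p c (insert q n) true) = 0 at hμ''
      omega
    · change finrank (ZMod p) (SelQP W K p c (insert q n) false) = 0 at hμ''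
      omega
  -- (γ) one prime up, then (A⇐) reads the value on the class
  obtain ⟨v, -, hdet⟩ := lawAn q hqn (anchorn q hqn hzero)
  exact ne_zero_of_not_mem_torsionLocalKer W K p hdet

/-! ## §2 The base case from the anchor at odd levels -/

/-- **`baseCase` FROM THE RANK-0 ANCHOR AT ODD LEVELS** (W. Zhang's proof of Thm. 7.2 run at an arbitrary even level).
Inputs: (A1) rank lowering at one more admissible prime in binder form (the LANDED `stub_rankLoweringAdditive` at a ♯ frame);
(A⇐) with `m = ∅` for `n` even and `q ∉ n` (finite part of the conductor-one class at a NEW prime ⟸ the value one level up,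
BD05 Thm. 4.2 ∕ Zhang (4.8)); (γ) the ANCHOR at ODD levels: `dim Sel_{n'}⁺ + dim Sel_{n'}⁻ = 0 ⟹ λ(∅, n') ≠ 0` (Zhang
Thm. 7.1 for the level-raised form of odd level `n'`, with the Gross formula). Output: at EVERY even level `n` (also `n = ∅`)
of total canonical rank one, `κ₀(∅, n) ≠ 0` — the carrier's field `baseCase` (which asks it at non-empty even levels).
[cite: WZhang2014, Thm. 7.2 (proof), Thm. 7.1, Prop. 5.4, (4.8)] -/
theorem baseCase_of_oddLevelAnchor
    {κ₀ : Finset {ℓ // Zhang2014.IsKolyvaginPrime (W.conductorNorm ℤ) W K p ℓ} → Finset (AdmQ W K p) → Vp W K p}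
    {lam : Finset {ℓ // Zhang2014.IsKolyvaginPrime (W.conductorNorm ℤ) W K p ℓ} → Finset (AdmQ W K p) → ZMod p}
    (hA1 : ∀ (n : Finset (AdmQ W K p)) (μ : Bool) (x : Vp W K p), x ∈ SelQP W K p c n μ → x ≠ 0 →
      ∃ q : AdmQ W K p, q ∉ n ∧ x ∉ SelQP W K p c (insert q n) μ ∧
        SelQP W K p c (insert q n) μ ≤ SelQP W K p c n μ ∧
        finrank (ZMod p) (SelQP W K p c (insert q n) μ) + 1 = finrank (ZMod p) (SelQP W K p c n μ) ∧
        SelQP W K p c (insert q n) (!μ) = SelQP W K p c n (!μ))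
    (lawA : ∀ (n : Finset (AdmQ W K p)) (q : AdmQ W K p), Even n.card → q ∉ n →
      ∀ m : Finset {ℓ // Zhang2014.IsKolyvaginPrime (W.conductorNorm ℤ) W K p ℓ},
      lam m (insert q n) ≠ 0 → ∃ v : HeightOneSpectrum (𝓞 K), ((q : ℕ) : 𝓞 K) ∈ v.asIdeal ∧
        κ₀ m n ∉ (W.baseChange K).torsionLocalKer (v.adicCompletion K) ((p ^ 1 : ℕ) : ℤ))
    (anchor : ∀ n : Finset (AdmQ W K p), Odd n.card →
      finrank (ZMod p) (SelQP W K p c n true) + finrank (ZMod p) (SelQP W K p c n false) = 0 → lam ∅ n ≠ 0) :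
    ∀ n : Finset (AdmQ W K p), Even n.card →
      finrank (ZMod p) (SelQP W K p c n true) + finrank (ZMod p) (SelQP W K p c n false) = 1 → κ₀ ∅ n ≠ 0 :=
  fun n he h1 ↦ ne_zero_of_anchor_above W K p c n (lamq := fun q ↦ lam ∅ (insert q n)) (hA1 n)
    (fun q hqn hlam ↦ lawA n q he hqn ∅ hlam)
    (fun q hqn h0 ↦ anchor (insert q n) ((odd_card_insert_iff hqn).mpr he) h0) h1

/-! ## §3 The first floor: BOT′'s conclusion from the one-prime levels -/

section FirstFloor

variable [W.IsElliptic] [NeZero (W.conductorNorm ℤ)]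
  (Dt : ModularParametrizationData W (W.conductorNorm ℤ)) (β : ℤ) (ι : K →+* ℂ)

/-- **THE FIRST FLOOR: `c(1) ≢ 0 (mod p)` at `#Sel_p(E/K) = p` from the one-prime levels.** Let `K` be imaginary quadratic,
`p` odd, `c` an involution of `K`, `#Sel_p(E/K) = p`, and `d` a conductor-one Kolyvagin–Heegner datum of the frame. GIVEN:
(A1) at level `∅` (a non-zero class of `Sel_∅^μ` dies in `Sel_{q}^μ` for a NEW admissible `q`, codimension one, other sign
unchanged — LANDED at ♯ frames); values `λ_q ∈ 𝔽_p` at the one-prime levels with (A⇐) at level `∅`: `λ_q ≠ 0 ⟹ loc_q c(1) ≠ 0`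
(Gross ∕ Jochnowitz special-value formula read on the class, BD05 Thm. 4.2 at the bottom); and (γ) at the one-prime levels:
`Sel_{q} = 0 ⟹ λ_q ≠ 0` (Zhang Thm. 7.1 for the form raised at ONE admissible prime) — THEN `d.kolyvaginClass ≠ 0`. This is
the conclusion of crux BOT′ (`BottomRankOneAdditive`) from the FIRST FLOOR of the bipartite system, W. Zhang's proof of Thm. 7.2
verbatim (the `p`-generic, Brandt-free analogue of koly g16's `Method2DefiniteFirstFloor`). [cite: WZhang2014, Thm. 7.2 (proof
pp. 232–233), Thm. 7.1, (4.8)] [cite: GrossLMS1991, §10] -/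
theorem kolyvaginClass_one_ne_zero_of_firstFloor (hp2 : p ≠ 2) (hK : IsImaginaryQuadratic K) (hcc : c * c = 1)
    (d : KolyvaginHeegnerData Dt β ι 1) {lamq : AdmQ W K p → ZMod p}
    (hA1 : ∀ (μ : Bool) (x : Vp W K p), x ∈ SelQP W K p c ∅ μ → x ≠ 0 →
      ∃ q : AdmQ W K p, x ∉ SelQP W K p c {q} μ ∧
        SelQP W K p c {q} μ ≤ SelQP W K p c ∅ μ ∧
        finrank (ZMod p) (SelQP W K p c {q} μ) + 1 = finrank (ZMod p) (SelQP W K p c ∅ μ) ∧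
        SelQP W K p c {q} (!μ) = SelQP W K p c ∅ (!μ))
    (lawA : ∀ q : AdmQ W K p, lamq q ≠ 0 → ∃ v : HeightOneSpectrum (𝓞 K), ((q : ℕ) : 𝓞 K) ∈ v.asIdeal ∧
      d.kolyvaginClass (Fact.out : p.Prime) 1 ∉
        (W.baseChange K).torsionLocalKer (v.adicCompletion K) ((p ^ 1 : ℕ) : ℤ))
    (anchor : ∀ q : AdmQ W K p,
      finrank (ZMod p) (SelQP W K p c {q} true) + finrank (ZMod p) (SelQP W K p c {q} false) = 0 → lamq q ≠ 0)
    (hsel : Nat.card (WeierstrassCurve.selmerGroup (W.baseChange K) (p : ℤ)) = p) :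
    d.kolyvaginClass (Fact.out : p.Prime) 1 ≠ 0 := by
  have e1 : ((p ^ 1 : ℕ) : ℤ) = (p : ℤ) := by simp
  have hsel' : Nat.card (selmerGroup (W.baseChange K) ((p ^ 1 : ℕ) : ℤ)) = p := by rw [e1]; exact hsel
  have h1 : finrank (ZMod p) (SelQP W K p c ∅ true) + finrank (ZMod p) (SelQP W K p c ∅ false) = 1 :=
    (finrank_selQP_empty_add_eq_one_iff W K p hp2 hK c hcc).mpr hsel'
  refine ne_zero_of_anchor_above W K p c ∅ (lamq := lamq) (fun μ x hx hx0 ↦ ?_) (fun q _ hq ↦ lawA q hq)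
    (fun q _ h0 ↦ anchor q (by rw [Finset.insert_empty] at h0; exact h0)) h1
  obtain ⟨q, h⟩ := hA1 μ x hx hx0
  exact ⟨q, Finset.notMem_empty q, by rw [Finset.insert_empty]; exact h⟩

/-- **The first floor AT A ♯ ADDITIVE FRAME** ((A1) discharged by the landed `stub_rankLoweringAdditive`): at a ♯ frame with
`#Sel_p(E/K) = p` and complex conjugation `c ≠ 1`, one-prime values `λ_q` with (A⇐) at level `∅` and (γ) at the one-prime levels
give `c(1) ≢ 0 (mod p)` for every conductor-one Kolyvagin–Heegner datum — BOT′'s conclusion at the frame from the first floor.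
[cite: WZhang2014, Thm. 7.2 (proof), Prop. 5.4, Lemma 7.3] -/
theorem kolyvaginClass_one_ne_zero_of_firstFloor_at_frame (h5 : 5 ≤ p) (hadd : Addv W p)
    (hsurj : W.HasSurjectiveModNGaloisRep p)
    (hsp : ∀ (ℓ : ℕ) [Fact ℓ.Prime], W.HasMultiplicativeReductionAtPrime ℓ →
      ¬ p ∣ padicValInt ℓ W.minimalDiscriminantInt)
    (htwo : ∃ (ℓ₁ ℓ₂ : ℕ) (_ : Fact ℓ₁.Prime) (_ : Fact ℓ₂.Prime), ℓ₁ ≠ ℓ₂ ∧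
      W.HasMultiplicativeReductionAtPrime ℓ₁ ∧ W.HasMultiplicativeReductionAtPrime ℓ₂)
    (htam : ¬ p ∣ W.tamagawaProduct) (hr : W.analyticRank = 1)
    (hK : IsImaginaryQuadratic K) (hodd : Odd (NumberField.discr K))
    (hH : SatisfiesHeegnerHypothesis (W.conductorNorm ℤ) K)
    (hL : (W.quadraticTwist (NumberField.discr K : ℚ)).entireLFunction 1 ≠ 0)
    (hβ : (4 * (W.conductorNorm ℤ : ℤ)) ∣ β ^ 2 - NumberField.discr K) (hcM : ¬ (p : ℤ) ∣ Dt.c) (hc1 : c ≠ 1)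
    (d : KolyvaginHeegnerData Dt β ι 1) {lamq : AdmQ W K p → ZMod p}
    (lawA : ∀ q : AdmQ W K p, lamq q ≠ 0 → ∃ v : HeightOneSpectrum (𝓞 K), ((q : ℕ) : 𝓞 K) ∈ v.asIdeal ∧
      d.kolyvaginClass (Fact.out : p.Prime) 1 ∉
        (W.baseChange K).torsionLocalKer (v.adicCompletion K) ((p ^ 1 : ℕ) : ℤ))
    (anchor : ∀ q : AdmQ W K p,
      finrank (ZMod p) (SelQP W K p c {q} true) + finrank (ZMod p) (SelQP W K p c {q} false) = 0 → lamq q ≠ 0)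
    (hsel : Nat.card (WeierstrassCurve.selmerGroup (W.baseChange K) (p : ℤ)) = p) :
    d.kolyvaginClass (Fact.out : p.Prime) 1 ≠ 0 := by
  have hp2 : p ≠ 2 := by omega
  have hA1 := stub_rankLoweringAdditive W p K Dt β ι h5 hadd hsurj hsp htwo htam hr hK hodd hH hL hβ hcM c hc1
  refine kolyvaginClass_one_ne_zero_of_firstFloor W K p c Dt β ι hp2 hK (Method2.algEquiv_mul_self_eq_one K hK c) d
    (lamq := lamq) (fun μ x hx hx0 ↦ ?_) lawA anchor hsel
  obtain ⟨q, -, h⟩ := hA1 ∅ μ x hx hx0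
  exact ⟨q, by rw [Finset.insert_empty] at h; exact h⟩

end FirstFloor

/-! ## §4 Assembly: a level Kolyvagin system from a bipartite datum -/

section Assembly

variable [W.IsElliptic] [NeZero (W.conductorNorm ℤ)]
  (Dt : ModularParametrizationData W (W.conductorNorm ℤ)) (β : ℤ) (ι : K →+* ℂ)

omit [W.IsElliptic] in
/-- **THE BIPARTITE DICTIONARY (abstract form).** A `LevelKolyvaginSystemP W K p Dt β ι c` EXISTS as soon as one has: classes
`κ₀(m, n)` owed at the EVEN levels only (realisation at `∅`; sign ∕ Kummer off the support ∕ toric on the level ∕ transverse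
on the conductor ∕ (8.1), each at even non-empty levels), values `λ(m, n) ∈ 𝔽_p` at the ODD levels, the reciprocity halves
(A⇐) and (B⇒), rank lowering (A1) in binder form, and the rank-0 ANCHOR (γ) at odd levels `dim Sel_{n'} = 0 ⟹ λ(∅, n') ≠ 0`
(`transport` by part 1 §2, `baseCase` by §2 here, odd levels filled with `0` by part 1 §1).
[cite: WZhang2014, §3, Thm. 4.3, Thm. 7.2, §8.1, §9] [cite: BertoliniDarmon2005, Thm. 4.1, Thm. 4.2] -/
theorem nonempty_levelKolyvaginSystemP_of_bipartite
    (ε₀ : Finset (AdmQ W K p) → Bool)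
    (κ₀ : Finset {ℓ // Zhang2014.IsKolyvaginPrime (W.conductorNorm ℤ) W K p ℓ} → Finset (AdmQ W K p) → Vp W K p)
    (lam : Finset {ℓ // Zhang2014.IsKolyvaginPrime (W.conductorNorm ℤ) W K p ℓ} → Finset (AdmQ W K p) → ZMod p)
    (realisation : ∀ m : Finset {ℓ // Zhang2014.IsKolyvaginPrime (W.conductorNorm ℤ) W K p ℓ},
      ∃ d : KolyvaginHeegnerData Dt β ι (∏ ℓ ∈ m, (ℓ : ℕ)), κ₀ m ∅ = d.kolyvaginClass (Fact.out : p.Prime) 1)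
    (sign : ∀ n : Finset (AdmQ W K p), n.Nonempty → Even n.card →
      ∀ m : Finset {ℓ // Zhang2014.IsKolyvaginPrime (W.conductorNorm ℤ) W K p ℓ},
      conjAct W c ((p ^ 1 : ℕ) : ℤ) (κ₀ m n) = sgnP (ε₀ n ^^ Nat.bodd m.card) • κ₀ m n)
    (selmer_off : ∀ n : Finset (AdmQ W K p), n.Nonempty → Even n.card →
      ∀ (m : Finset {ℓ // Zhang2014.IsKolyvaginPrime (W.conductorNorm ℤ) W K p ℓ}) (v : HeightOneSpectrum (𝓞 K)),
      (∀ ℓ ∈ m, ((ℓ : ℕ) : 𝓞 K) ∉ v.asIdeal) → (∀ q ∈ n, ((q : ℕ) : 𝓞 K) ∉ v.asIdeal) →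
      κ₀ m n ∈ selmerLocalKer (W.baseChange K) (v.adicCompletion K) ((p ^ 1 : ℕ) : ℤ))
    (selmer_inf : ∀ n : Finset (AdmQ W K p), n.Nonempty → Even n.card →
      ∀ (m : Finset {ℓ // Zhang2014.IsKolyvaginPrime (W.conductorNorm ℤ) W K p ℓ}) (w : InfinitePlace K),
      κ₀ m n ∈ selmerLocalKer (W.baseChange K) w.Completion ((p ^ 1 : ℕ) : ℤ))
    (toric_on : ∀ n : Finset (AdmQ W K p), n.Nonempty → Even n.card →
      ∀ m : Finset {ℓ // Zhang2014.IsKolyvaginPrime (W.conductorNorm ℤ) W K p ℓ}, ∀ q ∈ n,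
      ∀ v : HeightOneSpectrum (𝓞 K), ((q : ℕ) : 𝓞 K) ∈ v.asIdeal →
      κ₀ m n ∈ toricLocalKer (W.baseChange K) (v.adicCompletion K) ((p ^ 1 : ℕ) : ℤ))
    (transverse_on : ∀ n : Finset (AdmQ W K p), n.Nonempty → Even n.card →
      ∀ m : Finset {ℓ // Zhang2014.IsKolyvaginPrime (W.conductorNorm ℤ) W K p ℓ}, ∀ ℓ ∈ m,
      ∀ v : HeightOneSpectrum (𝓞 K), ((ℓ : ℕ) : 𝓞 K) ∈ v.asIdeal → κ₀ m n ∈ transverseLocalKerP W K p ι ℓ v)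
    (relation : ∀ n : Finset (AdmQ W K p), n.Nonempty → Even n.card →
      ∀ (m : Finset {ℓ // Zhang2014.IsKolyvaginPrime (W.conductorNorm ℤ) W K p ℓ})
        (ℓ : {ℓ // Zhang2014.IsKolyvaginPrime (W.conductorNorm ℤ) W K p ℓ}), ℓ ∉ m → ∀ v : HeightOneSpectrum (𝓞 K),
      ((ℓ : ℕ) : 𝓞 K) ∈ v.asIdeal →
      (κ₀ (insert ℓ m) n ∈ (W.baseChange K).torsionLocalKer (v.adicCompletion K) ((p ^ 1 : ℕ) : ℤ) ↔
        κ₀ m n ∈ (W.baseChange K).torsionLocalKer (v.adicCompletion K) ((p ^ 1 : ℕ) : ℤ)))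
    (lawA : ∀ (n : Finset (AdmQ W K p)) (q : AdmQ W K p), Even n.card → q ∉ n →
      ∀ m : Finset {ℓ // Zhang2014.IsKolyvaginPrime (W.conductorNorm ℤ) W K p ℓ},
      lam m (insert q n) ≠ 0 → ∃ v : HeightOneSpectrum (𝓞 K), ((q : ℕ) : 𝓞 K) ∈ v.asIdeal ∧
        κ₀ m n ∉ (W.baseChange K).torsionLocalKer (v.adicCompletion K) ((p ^ 1 : ℕ) : ℤ))
    (lawB : ∀ (n : Finset (AdmQ W K p)) (q : AdmQ W K p), Odd n.card → q ∉ n →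
      ∀ (m : Finset {ℓ // Zhang2014.IsKolyvaginPrime (W.conductorNorm ℤ) W K p ℓ}) (v : HeightOneSpectrum (𝓞 K)),
      ((q : ℕ) : 𝓞 K) ∈ v.asIdeal →
      κ₀ m (insert q n) ∉ (W.baseChange K).torsionLocalKer (v.adicCompletion K) ((p ^ 1 : ℕ) : ℤ) → lam m n ≠ 0)
    (hA1 : ∀ (n : Finset (AdmQ W K p)) (μ : Bool) (x : Vp W K p), x ∈ SelQP W K p c n μ → x ≠ 0 →
      ∃ q : AdmQ W K p, q ∉ n ∧ x ∉ SelQP W K p c (insert q n) μ ∧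
        SelQP W K p c (insert q n) μ ≤ SelQP W K p c n μ ∧
        finrank (ZMod p) (SelQP W K p c (insert q n) μ) + 1 = finrank (ZMod p) (SelQP W K p c n μ) ∧
        SelQP W K p c (insert q n) (!μ) = SelQP W K p c n (!μ))
    (anchor : ∀ n : Finset (AdmQ W K p), Odd n.card →
      finrank (ZMod p) (SelQP W K p c n true) + finrank (ZMod p) (SelQP W K p c n false) = 0 → lam ∅ n ≠ 0) :
    Nonempty (LevelKolyvaginSystemP W K p Dt β ι c) :=
  nonempty_levelKolyvaginSystemP_of_evenLevels W K p c Dt β ι ε₀ κ₀ realisation sign selmer_off selmer_inf toric_on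
    transverse_on relation (transport_of_reciprocityLaws W K p lawA lawB)
    (fun n _ he h1 ↦ baseCase_of_oddLevelAnchor W K p c hA1 lawA anchor n he h1)

/-- **THE BIPARTITE DICTIONARY AT A ♯ ADDITIVE FRAME.** At a ♯ additive frame of the route (`p ≥ 5`, `Addv W p`, `ρ̄_{E,p}`
onto, ♠(1) ∕ ♠(2), `p ∤ ∏ c_ℓ`, `r_an = 1`, `K` imaginary quadratic with odd `d_K`, Heegner hypothesis, `L(E^{d_K}, 1) ≠ 0`,
`4N ∣ β² − d_K`, `p ∤ c_Manin`) with complex conjugation `c ≠ 1`: a bipartite datum — even-level classes `κ₀` with the local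
axioms, odd-level values `λ`, laws (A⇐) ∕ (B⇒), the rank-0 ANCHOR (γ) at odd levels — yields KS′'s
`Nonempty (LevelKolyvaginSystemP W K p Dt β ι c)`; rank lowering (A1) is DISCHARGED by the landed `stub_rankLoweringAdditive`
(p521749). What KS′ asks beyond the E-side is thus exactly: the bipartite system (type-preserving level raising + BD
reciprocity at `p²`-level) and the anchor (γ) at the DEFINITE levels. [cite: WZhang2014, §3, Thm. 4.3, Prop. 5.4, Thm. 7.1,
Thm. 7.2, §9] [cite: BertoliniDarmon2005, Thm. 4.1, Thm. 4.2] -/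
theorem nonempty_levelKolyvaginSystemP_of_bipartite_at_frame (h5 : 5 ≤ p) (hadd : Addv W p)
    (hsurj : W.HasSurjectiveModNGaloisRep p)
    (hsp : ∀ (ℓ : ℕ) [Fact ℓ.Prime], W.HasMultiplicativeReductionAtPrime ℓ →
      ¬ p ∣ padicValInt ℓ W.minimalDiscriminantInt)
    (htwo : ∃ (ℓ₁ ℓ₂ : ℕ) (_ : Fact ℓ₁.Prime) (_ : Fact ℓ₂.Prime), ℓ₁ ≠ ℓ₂ ∧
      W.HasMultiplicativeReductionAtPrime ℓ₁ ∧ W.HasMultiplicativeReductionAtPrime ℓ₂)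
    (htam : ¬ p ∣ W.tamagawaProduct) (hr : W.analyticRank = 1)
    (hK : IsImaginaryQuadratic K) (hodd : Odd (NumberField.discr K))
    (hH : SatisfiesHeegnerHypothesis (W.conductorNorm ℤ) K)
    (hL : (W.quadraticTwist (NumberField.discr K : ℚ)).entireLFunction 1 ≠ 0)
    (hβ : (4 * (W.conductorNorm ℤ : ℤ)) ∣ β ^ 2 - NumberField.discr K) (hcM : ¬ (p : ℤ) ∣ Dt.c) (hc1 : c ≠ 1)
    (ε₀ : Finset (AdmQ W K p) → Bool)
    (κ₀ : Finset {ℓ // Zhang2014.IsKolyvaginPrime (W.conductorNorm ℤ) W K p ℓ} → Finset (AdmQ W K p) → Vp W K p)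
    (lam : Finset {ℓ // Zhang2014.IsKolyvaginPrime (W.conductorNorm ℤ) W K p ℓ} → Finset (AdmQ W K p) → ZMod p)
    (realisation : ∀ m : Finset {ℓ // Zhang2014.IsKolyvaginPrime (W.conductorNorm ℤ) W K p ℓ},
      ∃ d : KolyvaginHeegnerData Dt β ι (∏ ℓ ∈ m, (ℓ : ℕ)), κ₀ m ∅ = d.kolyvaginClass (Fact.out : p.Prime) 1)
    (sign : ∀ n : Finset (AdmQ W K p), n.Nonempty → Even n.card →
      ∀ m : Finset {ℓ // Zhang2014.IsKolyvaginPrime (W.conductorNorm ℤ) W K p ℓ},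
      conjAct W c ((p ^ 1 : ℕ) : ℤ) (κ₀ m n) = sgnP (ε₀ n ^^ Nat.bodd m.card) • κ₀ m n)
    (selmer_off : ∀ n : Finset (AdmQ W K p), n.Nonempty → Even n.card →
      ∀ (m : Finset {ℓ // Zhang2014.IsKolyvaginPrime (W.conductorNorm ℤ) W K p ℓ}) (v : HeightOneSpectrum (𝓞 K)),
      (∀ ℓ ∈ m, ((ℓ : ℕ) : 𝓞 K) ∉ v.asIdeal) → (∀ q ∈ n, ((q : ℕ) : 𝓞 K) ∉ v.asIdeal) →
      κ₀ m n ∈ selmerLocalKer (W.baseChange K) (v.adicCompletion K) ((p ^ 1 : ℕ) : ℤ))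
    (selmer_inf : ∀ n : Finset (AdmQ W K p), n.Nonempty → Even n.card →
      ∀ (m : Finset {ℓ // Zhang2014.IsKolyvaginPrime (W.conductorNorm ℤ) W K p ℓ}) (w : InfinitePlace K),
      κ₀ m n ∈ selmerLocalKer (W.baseChange K) w.Completion ((p ^ 1 : ℕ) : ℤ))
    (toric_on : ∀ n : Finset (AdmQ W K p), n.Nonempty → Even n.card →
      ∀ m : Finset {ℓ // Zhang2014.IsKolyvaginPrime (W.conductorNorm ℤ) W K p ℓ}, ∀ q ∈ n,
      ∀ v : HeightOneSpectrum (𝓞 K), ((q : ℕ) : 𝓞 K) ∈ v.asIdeal →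
      κ₀ m n ∈ toricLocalKer (W.baseChange K) (v.adicCompletion K) ((p ^ 1 : ℕ) : ℤ))
    (transverse_on : ∀ n : Finset (AdmQ W K p), n.Nonempty → Even n.card →
      ∀ m : Finset {ℓ // Zhang2014.IsKolyvaginPrime (W.conductorNorm ℤ) W K p ℓ}, ∀ ℓ ∈ m,
      ∀ v : HeightOneSpectrum (𝓞 K), ((ℓ : ℕ) : 𝓞 K) ∈ v.asIdeal → κ₀ m n ∈ transverseLocalKerP W K p ι ℓ v)
    (relation : ∀ n : Finset (AdmQ W K p), n.Nonempty → Even n.card →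
      ∀ (m : Finset {ℓ // Zhang2014.IsKolyvaginPrime (W.conductorNorm ℤ) W K p ℓ})
        (ℓ : {ℓ // Zhang2014.IsKolyvaginPrime (W.conductorNorm ℤ) W K p ℓ}), ℓ ∉ m → ∀ v : HeightOneSpectrum (𝓞 K),
      ((ℓ : ℕ) : 𝓞 K) ∈ v.asIdeal →
      (κ₀ (insert ℓ m) n ∈ (W.baseChange K).torsionLocalKer (v.adicCompletion K) ((p ^ 1 : ℕ) : ℤ) ↔
        κ₀ m n ∈ (W.baseChange K).torsionLocalKer (v.adicCompletion K) ((p ^ 1 : ℕ) : ℤ)))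
    (lawA : ∀ (n : Finset (AdmQ W K p)) (q : AdmQ W K p), Even n.card → q ∉ n →
      ∀ m : Finset {ℓ // Zhang2014.IsKolyvaginPrime (W.conductorNorm ℤ) W K p ℓ},
      lam m (insert q n) ≠ 0 → ∃ v : HeightOneSpectrum (𝓞 K), ((q : ℕ) : 𝓞 K) ∈ v.asIdeal ∧
        κ₀ m n ∉ (W.baseChange K).torsionLocalKer (v.adicCompletion K) ((p ^ 1 : ℕ) : ℤ))
    (lawB : ∀ (n : Finset (AdmQ W K p)) (q : AdmQ W K p), Odd n.card → q ∉ n →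
      ∀ (m : Finset {ℓ // Zhang2014.IsKolyvaginPrime (W.conductorNorm ℤ) W K p ℓ}) (v : HeightOneSpectrum (𝓞 K)),
      ((q : ℕ) : 𝓞 K) ∈ v.asIdeal →
      κ₀ m (insert q n) ∉ (W.baseChange K).torsionLocalKer (v.adicCompletion K) ((p ^ 1 : ℕ) : ℤ) → lam m n ≠ 0)
    (anchor : ∀ n : Finset (AdmQ W K p), Odd n.card →
      finrank (ZMod p) (SelQP W K p c n true) + finrank (ZMod p) (SelQP W K p c n false) = 0 → lam ∅ n ≠ 0) :
    Nonempty (LevelKolyvaginSystemP W K p Dt β ι c) :=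
  nonempty_levelKolyvaginSystemP_of_bipartite W K p c Dt β ι ε₀ κ₀ lam realisation sign selmer_off selmer_inf toric_on
    transverse_on relation lawA lawB
    (stub_rankLoweringAdditive W p K Dt β ι h5 hadd hsurj hsp htwo htam hr hK hodd hH hL hβ hcM c hc1) anchor

end Assembly

end Summit.BirchSwinnertonDyer.BirchSwinnertonDyer.Theorems.AdditiveKoly

end
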